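import Summits.HubbardSuperconductivity.HubbardSuperconductivity.Theorems.PerWidthThermodynamics.Negative.ZeroCouplingCompressibility

/-!
# Shell counting on the free tubes (1/2): closed shells of the square torus below half filling hold
# `1 mod 4` momenta

Negative-side support for crux `SeamGluingLocality` (stmt-HubbardSuperconductivity-18509), consumed by
`SeamGluingLocality/Negative/ZeroCouplingDegeneracy.lean` (the `U = 0` twin of the crux is false: the
disprover's near-miss `not_seamGluingLocalityFromZeroU` of `Cruxes/SeamGluingLocality/Disproof.lean`).
Pure counting about the free band `ε_{L,M}(a,b) = -2cos(2πa/L) - 2cos(2πb/M)` (`tubeBand`), sorry-free: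

* `card_filter_tubeBand_le_mod_four` — on the SQUARE torus `ℤ/L × ℤ/L`, `L` even, every cumulative
  shell count `#{ε_{L,L} ≤ μ}` with `-4 ≤ μ < 0` is `≡ 1 (mod 4)`: the quarter rotation
  `(a,b) ↦ (-b,a)` acts freely off the four points `{0,L/2}²`, of which only `(0,0)` lies below a
  negative level (the half-period rows/columns have `ε ≥ 0`);
* `tubeBand_add_half` — the shift by `(L/2, M/2)` negates the band (`L, M` even); `tubeBand_rot` —
  the quarter rotation preserves the square band; signed-representative bookkeeping in `ℤ/L`.
(Part 2/2, `FreeBandMultiplicity.lean`: level multiplicities `≤ 2L`, room below half filling, closed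
shells near every target filling.)

Folklore (free-electron shell structure; e.g. D. J. Scalapino, S. R. White, S. C. Zhang, PRB 47 (1993)
7995 §II for the role of open/closed shells in the free compressibility). No definitions, no named
facts. REUSED: `cos_two_pi_mul_val_neg`, `cos_two_pi_mul_val_half`, `neg_four_le_tubeBand`, `val_half`
(the `U = 0` negatives of 18510/16312).
-/

noncomputable section

namespace Summit.HubbardSuperconductivity.HubbardSuperconductivity.Theorems.SeamGluingLocality.Negative

set_option linter.dupNamespace false -- summit = problem name (single-conjunct summit), D-0017

open scoped BigOperators Classical
open Finset Summit.HubbardSuperconductivity.HubbardSuperconductivity.Theorems.WidthHaldane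
open Summit.HubbardSuperconductivity.HubbardSuperconductivity.Theorems.WidthUniformThermodynamics.Negative
open Summit.HubbardSuperconductivity.HubbardSuperconductivity.Theorems.PerWidthThermodynamics.Negative

/-! ### Signed representatives in `ℤ/L` -/

section Signed

variable {L : ℕ} [NeZero L]

/-- For `a ≠ 0` in `ℤ/L` the representative of `-a` is `L - a.val`. [folklore] -/
theorem neg_val_of_ne_zero {a : ZMod L} (h : a ≠ 0) : (-a).val = L - a.val := by
  rw [ZMod.neg_val, if_neg h]

/-- `-a` lies in the open upper half of the representatives iff `a` lies in the open lower half.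
[folklore] -/
theorem lt_two_mul_val_neg_iff (a : ZMod L) : L < 2 * (-a).val ↔ 0 < a.val ∧ 2 * a.val < L := by
  by_cases h : a = 0
  · subst h
    rw [neg_zero, ZMod.val_zero]
    constructor
    · intro h; omega
    · intro h; omega
  · rw [neg_val_of_ne_zero h]
    have h1 := ZMod.val_lt a
    have h2 : 0 < a.val := Nat.pos_of_ne_zero fun hv => h ((ZMod.val_eq_zero a).1 hv)
    constructor
    · intro h; omega
    · intro h; omega

/-- `-a` lies in the open lower half of the representatives iff `a` lies in the open upper half.
[folklore] -/
theorem val_neg_pos_iff (a : ZMod L) : (0 < (-a).val ∧ 2 * (-a).val < L) ↔ L < 2 * a.val := by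
  have h := lt_two_mul_val_neg_iff (-a)
  rw [neg_neg] at h
  exact h.symm

/-- An element whose doubled representative is `L` is the half period `L/2`. [folklore] -/
theorem eq_half_of_two_mul_val {a : ZMod L} (h : 2 * a.val = L) : a = ((L / 2 : ℕ) : ZMod L) := by
  have hv : a.val = L / 2 := by omega
  rw [← ZMod.natCast_zmod_val a, hv]

end Signed

/-! ### Band symmetries -/

section Band

variable {L M : ℕ} [NeZero L] [NeZero M]

omit [NeZero M] in
/-- A momentum whose first coordinate is the half period has `ε_{L,M} = 2 - 2cos ≥ 0`. [folklore] -/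
theorem tubeBand_nonneg_of_fst (k : ZMod L × ZMod M) (h : 2 * k.1.val = L) : 0 ≤ tubeBand L M k := by
  have hL : Even L := ⟨k.1.val, by omega⟩
  have hk : k.1 = ((L / 2 : ℕ) : ZMod L) := eq_half_of_two_mul_val h
  have hc := Real.cos_le_one (2 * Real.pi * (k.2.val : ℝ) / M)
  rw [tubeBand, hk, cos_two_pi_mul_val_half hL]
  linarith

omit [NeZero L] in
/-- A momentum whose second coordinate is the half period has `ε_{L,M} ≥ 0`. [folklore] -/
theorem tubeBand_nonneg_of_snd (k : ZMod L × ZMod M) (h : 2 * k.2.val = M) : 0 ≤ tubeBand L M k := by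
  have hM : Even M := ⟨k.2.val, by omega⟩
  have hk : k.2 = ((M / 2 : ℕ) : ZMod M) := eq_half_of_two_mul_val h
  have hc := Real.cos_le_one (2 * Real.pi * (k.1.val : ℝ) / L)
  rw [tubeBand, hk, cos_two_pi_mul_val_half hM]
  linarith

omit [NeZero L] [NeZero M] in
/-- The band at the origin is `-4`. [folklore] -/
theorem tubeBand_zero_zero : tubeBand L M ((0 : ZMod L), (0 : ZMod M)) = -4 := by
  rw [tubeBand, cos_two_pi_mul_val_zero, cos_two_pi_mul_val_zero]; norm_num

/-- The quarter rotation `(a, b) ↦ (-b, a)` preserves the band of the SQUARE torus. [folklore] -/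
theorem tubeBand_rot (k : ZMod L × ZMod L) : tubeBand L L (-k.2, k.1) = tubeBand L L k := by
  rw [tubeBand, tubeBand]
  dsimp only
  rw [cos_two_pi_mul_val_neg]
  ring

/-- `cos (2π n / L)` only depends on `n mod L`. [folklore] -/
theorem cos_two_pi_mul_mod (n : ℕ) :
    Real.cos (2 * Real.pi * ((n % L : ℕ) : ℝ) / L) = Real.cos (2 * Real.pi * (n : ℝ) / L) := by
  have hL0 : (L : ℝ) ≠ 0 := Nat.cast_ne_zero.2 (NeZero.ne L)
  have hn : ((n % L : ℕ) : ℝ) = n - L * ((n / L : ℕ) : ℝ) := by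
    have h := Nat.mod_add_div n L
    have h' : (((n % L : ℕ) : ℝ)) + (L : ℝ) * ((n / L : ℕ) : ℝ) = n := by exact_mod_cast h
    linarith
  have : 2 * Real.pi * ((n % L : ℕ) : ℝ) / L + ((n / L : ℕ) : ℝ) * (2 * Real.pi) =
      2 * Real.pi * (n : ℝ) / L := by
    rw [hn]; field_simp; ring
  rw [← Real.cos_add_nat_mul_two_pi _ (n / L), this]

/-- Shifting by the half period flips the sign of the cosine: `cos(2π(a + L/2)/L) = -cos(2πa/L)` for
even `L`. [folklore] -/
theorem cos_two_pi_mul_val_add_half (hL : Even L) (a : ZMod L) :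
    Real.cos (2 * Real.pi * (((a + ((L / 2 : ℕ) : ZMod L)).val : ℕ) : ℝ) / L) =
      -Real.cos (2 * Real.pi * (a.val : ℝ) / L) := by
  have hL0 : (L : ℝ) ≠ 0 := Nat.cast_ne_zero.2 (NeZero.ne L)
  rw [ZMod.val_add, val_half, cos_two_pi_mul_mod]
  have h2 : ((L / 2 : ℕ) : ℝ) * 2 = L := by exact_mod_cast Nat.div_two_mul_two_of_even hL
  have : 2 * Real.pi * (((a.val + L / 2 : ℕ)) : ℝ) / L = 2 * Real.pi * (a.val : ℝ) / L + Real.pi := by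
    push_cast
    field_simp
    linarith [h2]
  rw [this, Real.cos_add_pi]

/-- The shift by `(L/2, M/2)` negates the band (`L, M` even): `ε(k + (L/2, M/2)) = -ε(k)`. [folklore] -/
theorem tubeBand_add_half (hL : Even L) (hM : Even M) (k : ZMod L × ZMod M) :
    tubeBand L M (k + (((L / 2 : ℕ) : ZMod L), ((M / 2 : ℕ) : ZMod M))) = -tubeBand L M k := by
  rw [tubeBand, tubeBand, Prod.fst_add, Prod.snd_add, cos_two_pi_mul_val_add_half hL,
    cos_two_pi_mul_val_add_half hM]
  ring

end Band

/-! ### Closed shells of the square torus below half filling hold `1 mod 4` momenta -/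

section ModFour

variable {L : ℕ} [NeZero L]

/-- **Closed shells of the free square torus below half filling hold `1 (mod 4)` momenta.** For even
`L` and `-4 ≤ μ < 0`, `#{k ∈ ℤ/L × ℤ/L : ε_{L,L}(k) ≤ μ} ≡ 1 (mod 4)`: below a negative level no momentum
has a half-period coordinate (`ε ≥ 0` there), so apart from the origin the shell splits into the four
quadrants `{a > 0, b ≥ 0}`, `{a ≤ 0, b > 0}`, `{a < 0, b ≤ 0}`, `{a ≥ 0, b < 0}` (signed
representatives), which the band-preserving quarter rotation `(a,b) ↦ (-b,a)` permutes cyclically.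
[folklore] -/
theorem card_filter_tubeBand_le_mod_four (hL : Even L) {μ : ℝ} (hμ : μ < 0) (hμ' : -4 ≤ μ) :
    (univ.filter fun k : ZMod L × ZMod L => tubeBand L L k ≤ μ).card % 4 = 1 := by
  have _ := hL
  set S := univ.filter fun k : ZMod L × ZMod L => tubeBand L L k ≤ μ with hS
  -- no half-period coordinates below a negative level
  have hh1 : ∀ k ∈ S, 2 * k.1.val ≠ L := fun k hk h => by
    have h0 := tubeBand_nonneg_of_fst k h
    rw [hS, mem_filter] at hk
    linarith [hk.2]
  have hh2 : ∀ k ∈ S, 2 * k.2.val ≠ L := fun k hk h => by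
    have h0 := tubeBand_nonneg_of_snd k h
    rw [hS, mem_filter] at hk
    linarith [hk.2]
  have hz : ∀ a : ZMod L, a = 0 → a.val = 0 := fun a h => by rw [h, ZMod.val_zero]
  have hnz : ∀ a : ZMod L, a ≠ 0 → 0 < a.val := fun a h =>
    Nat.pos_of_ne_zero fun hv => h ((ZMod.val_eq_zero a).1 hv)
  -- the four quadrants (signed representatives: `P a` = `0 < a < L/2`, `N a` = `L/2 < a`)
  set F0 := univ.filter fun k : ZMod L × ZMod L => tubeBand L L k ≤ μ ∧
    ((0 < k.1.val ∧ 2 * k.1.val < L) ∧ (k.2 = 0 ∨ (0 < k.2.val ∧ 2 * k.2.val < L))) with hF0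
  set F1 := univ.filter fun k : ZMod L × ZMod L => tubeBand L L k ≤ μ ∧
    ((k.1 = 0 ∨ L < 2 * k.1.val) ∧ (0 < k.2.val ∧ 2 * k.2.val < L)) with hF1
  set F2 := univ.filter fun k : ZMod L × ZMod L => tubeBand L L k ≤ μ ∧
    (L < 2 * k.1.val ∧ (k.2 = 0 ∨ L < 2 * k.2.val)) with hF2
  set F3 := univ.filter fun k : ZMod L × ZMod L => tubeBand L L k ≤ μ ∧
    ((k.1 = 0 ∨ (0 < k.1.val ∧ 2 * k.1.val < L)) ∧ L < 2 * k.2.val) with hF3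
  -- the quarter rotation
  set ρ : ZMod L × ZMod L ≃ ZMod L × ZMod L :=
    (Equiv.prodComm (ZMod L) (ZMod L)).trans
      (Equiv.prodCongr (Equiv.neg (ZMod L)) (Equiv.refl (ZMod L))) with hρ
  have hρk : ∀ k : ZMod L × ZMod L, ρ k = (-k.2, k.1) := fun k => rfl
  have h01 : F0.card = F1.card := by
    refine Finset.card_equiv ρ fun k => ?_
    rw [hF0, hF1, mem_filter, mem_filter, hρk, tubeBand_rot, neg_eq_zero, lt_two_mul_val_neg_iff]
    simp only [mem_univ, true_and]
    constructor
    · rintro ⟨h, hP, hQ⟩; exact ⟨h, hQ, hP⟩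
    · rintro ⟨h, hQ, hP⟩; exact ⟨h, hP, hQ⟩
  have h12 : F1.card = F2.card := by
    refine Finset.card_equiv ρ fun k => ?_
    rw [hF1, hF2, mem_filter, mem_filter, hρk, tubeBand_rot, lt_two_mul_val_neg_iff]
    simp only [mem_univ, true_and]
    constructor
    · rintro ⟨h, hP, hQ⟩; exact ⟨h, hQ, hP⟩
    · rintro ⟨h, hQ, hP⟩; exact ⟨h, hP, hQ⟩
  have h23 : F2.card = F3.card := by
    refine Finset.card_equiv ρ fun k => ?_
    rw [hF2, hF3, mem_filter, mem_filter, hρk, tubeBand_rot, neg_eq_zero, val_neg_pos_iff]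
    simp only [mem_univ, true_and]
    constructor
    · rintro ⟨h, hP, hQ⟩; exact ⟨h, hQ, hP⟩
    · rintro ⟨h, hQ, hP⟩; exact ⟨h, hP, hQ⟩
  -- pairwise disjointness of the quadrants
  have d02 : Disjoint F0 F2 := by
    rw [hF0, hF2, Finset.disjoint_filter]; intro k _ h h'; omega
  have d13 : Disjoint F1 F3 := by
    rw [hF1, hF3, Finset.disjoint_filter]; intro k _ h h'; omega
  have d01 : Disjoint F0 F1 := by
    rw [hF0, hF1, Finset.disjoint_filter]
    rintro k - ⟨-, hP, -⟩ ⟨-, hQ | hQ, -⟩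
    · have := hz _ hQ; omega
    · omega
  have d03 : Disjoint F0 F3 := by
    rw [hF0, hF3, Finset.disjoint_filter]
    rintro k - ⟨-, -, hP | hP⟩ ⟨-, -, hQ⟩
    · have := hz _ hP; omega
    · omega
  have d21 : Disjoint F2 F1 := by
    rw [hF2, hF1, Finset.disjoint_filter]
    rintro k - ⟨-, -, hP | hP⟩ ⟨-, -, hQ⟩
    · have := hz _ hP; omega
    · omega
  have d23 : Disjoint F2 F3 := by
    rw [hF2, hF3, Finset.disjoint_filter]
    rintro k - ⟨-, hP, -⟩ ⟨-, hQ | hQ, -⟩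
    · have := hz _ hQ; omega
    · omega
  -- the origin
  have h00 : ((0 : ZMod L), (0 : ZMod L)) ∈ S := by
    rw [hS, mem_filter]
    exact ⟨mem_univ _, by rw [tubeBand_zero_zero]; exact hμ'⟩
  have horigin : (S.filter fun k => k = ((0 : ZMod L), (0 : ZMod L))) = {((0 : ZMod L), (0 : ZMod L))} := by
    ext k
    simp only [mem_filter, mem_singleton]
    exact ⟨fun h => h.2, fun h => ⟨h ▸ h00, h⟩⟩
  -- the punctured shell is the union of the four quadrants
  have hSmem : ∀ k : ZMod L × ZMod L, k ∈ S ↔ tubeBand L L k ≤ μ := fun k => by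
    rw [hS, mem_filter]; exact ⟨fun h => h.2, fun h => ⟨mem_univ _, h⟩⟩
  have hunion : (S.filter fun k => ¬ k = ((0 : ZMod L), (0 : ZMod L))) = (F0 ∪ F2) ∪ (F1 ∪ F3) := by
    ext k
    rw [hF0, hF1, hF2, hF3]
    simp only [mem_union, mem_filter, mem_univ, true_and, hSmem]
    constructor
    · rintro ⟨hε, hk0⟩
      have hk : k ∈ S := (hSmem k).2 hε
      have hn1 := hh1 k hk
      have hn2 := hh2 k hk
      -- trichotomy of both coordinates
      have t1 : k.1 = 0 ∨ (0 < k.1.val ∧ 2 * k.1.val < L) ∨ L < 2 * k.1.val := by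
        by_cases h : k.1 = 0
        · exact Or.inl h
        · have := hnz _ h; right; omega
      have t2 : k.2 = 0 ∨ (0 < k.2.val ∧ 2 * k.2.val < L) ∨ L < 2 * k.2.val := by
        by_cases h : k.2 = 0
        · exact Or.inl h
        · have := hnz _ h; right; omega
      rcases t1 with h1 | h1 | h1 <;> rcases t2 with h2 | h2 | h2
      · exact absurd (Prod.ext h1 h2) hk0
      · exact Or.inr (Or.inl ⟨hε, Or.inl h1, h2⟩)
      · exact Or.inr (Or.inr ⟨hε, Or.inl h1, h2⟩)
      · exact Or.inl (Or.inl ⟨hε, h1, Or.inl h2⟩)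
      · exact Or.inl (Or.inl ⟨hε, h1, Or.inr h2⟩)
      · exact Or.inr (Or.inr ⟨hε, Or.inr h1, h2⟩)
      · exact Or.inl (Or.inr ⟨hε, h1, Or.inl h2⟩)
      · exact Or.inr (Or.inl ⟨hε, Or.inr h1, h2⟩)
      · exact Or.inl (Or.inr ⟨hε, h1, Or.inr h2⟩)
    · rintro ((⟨hε, hP, -⟩ | ⟨hε, hP, -⟩) | (⟨hε, -, hP⟩ | ⟨hε, -, hP⟩))
      · refine ⟨hε, fun h0 => ?_⟩
        have := hz _ (congrArg Prod.fst h0); omega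
      · refine ⟨hε, fun h0 => ?_⟩
        have := hz _ (congrArg Prod.fst h0); omega
      · refine ⟨hε, fun h0 => ?_⟩
        have := hz _ (congrArg Prod.snd h0); omega
      · refine ⟨hε, fun h0 => ?_⟩
        have := hz _ (congrArg Prod.snd h0); omega
  -- count
  have hsplit := card_filter_add_card_filter_not (s := S) (fun k => k = ((0 : ZMod L), (0 : ZMod L)))
  rw [horigin, card_singleton, hunion,
    card_union_of_disjoint (disjoint_union_left.2 ⟨disjoint_union_right.2 ⟨d01, d03⟩,
      disjoint_union_right.2 ⟨d21, d23⟩⟩),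
    card_union_of_disjoint d02, card_union_of_disjoint d13] at hsplit
  omega

end ModFour

end Summit.HubbardSuperconductivity.HubbardSuperconductivity.Theorems.SeamGluingLocality.Negative

end
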